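import Summits.ResolutionOfSingularities.ResolutionOfSingularities.Theorems.PurelyInseparableDim4SpineGame
import Summits.ResolutionOfSingularities.ResolutionOfSingularities.Theorems.PurelyInseparableDim4Perm2BoundOrigin
import Literature.AlgebraicGeometry.Resolution.CentreBlowupOrdAlongBasics
import HarnessLib

/-!
# [OURS · res-dim4-pi PR-11] Spine-game bookkeeping: `q`-clean positions take no deletions

Cell `res-dim4-pi` (D-0157 DOOR 2), brick **PR-11 «R_S support lemma»** (desk `boards/ROUTES.md` WORD #24 (a)),
seat `res-dim4-p-11` (width 11 of `res-dim4-p-1`).  Def-free bookkeeping over the desk's SPINE GAME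
(`PurelyInseparableDim4SpineGame.lean`, TY-9: positions `SpinePos = Finset (Fin 4 →₀ ℕ)`, `SpinePermissible`,
`pureMove`, `spineMove`, `SpineWon`, plays) — the two facts every spine certificate and the transfer lemmas
PR-9a / PR-9b cite:

* §1 `dvd_chartExponent_iff` — the support-level form of p-2's `Perm2Bound.isPthPowerExponent_chartExponent_iff`
  (p646720): under permissibility (`q ≤ degIn S a`, `j ∈ S`) the chart law `a ↦ chartExponent q S j a` preserves
  AND reflects `q`-divisible exponent vectors;
* §2 membership / cleanness: `spineMove_clean` (a spine move always returns a `q`-clean position),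
  `pureMove_clean` (a pure move from a `q`-clean permissible position returns a `q`-clean position),
  `spineMove_eq_pureMove_filter` (the spine move is the pure move of the clean part), and the headline
  **`spineMove_eq_pureMove`: from a `q`-CLEAN position a permissible spine move IS the pure move — no deletion
  happens** (desk WORD #23 (b) «no deletions on the spine for cleaned states»);
* §3 cardinalities: `card_pureMove` (`|pureMove A| = |A|`: the chart law is injective on the permissible range,
  p-2's `chartExponent_injOn`), `card_spineMove_add` (`|spineMove A| + #{q-divisible points of A} = |A|`:
  deletions are counted exactly), `card_spineMove_eq` (clean ⇒ `|spineMove A| = |A|`), next to TY-9's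
  `card_spineMove_le`;
* §4 one-step play forms: along a spine play every position from index `1` on is `q`-clean
  (`isSpinePlay_clean_succ`), and a spine step taken from a clean position under a permissible strategy is a
  pure step (`isSpinePlay_step_eq_pureMove`).  The play-level transfer `PurePositionalWin4 q → PositionalWin4 q`
  (PR-9a) and the support dictionary at `b = 0` (PR-9b) are NOT in this file (seats p-10 / p-7).

Everything is a statement about OUR frame's combinatorial support game; nothing here is a theorem about
resolution of singularities in dimension ≥ 4 / characteristic `p` (counted 0; AI work weaker than expert review).
bears_on: LADDER-RESOLUTION:D157-DOOR2 (res-dim4-pi · PR-11). Supports stmt-ResolutionOfSingularities-16155 (helper).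
-/

set_option linter.dupNamespace false -- mandated namespace of this single-conjunct summit

namespace Summit.ResolutionOfSingularities.ResolutionOfSingularities.Theorems.PIDim4

namespace SpineClean

open Finset
open Literature.AlgebraicGeometry.Resolution
open Literature.AlgebraicGeometry.Resolution.CentreBlowup

variable {q : ℕ} {S : Finset (Fin 4)} {j : Fin 4}

/-! ## §1 The chart law and `q`-divisibility (support form of p-2's lemma) -/

/-- Under condition (1) (`q ≤ degIn S a`, chart `j ∈ S`) the chart image `chartExponent q S j a` has all
coordinates divisible by `q` iff `a` has: the support-level reading of
`Perm2Bound.isPthPowerExponent_chartExponent_iff`. [folklore] -/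
theorem dvd_chartExponent_iff (hj : j ∈ S) {a : Fin 4 →₀ ℕ} (ha : q ≤ degIn S a) :
    (∀ i, q ∣ chartExponent q S j a i) ↔ ∀ i, q ∣ a i := by
  have h := Perm2Bound.isPthPowerExponent_chartExponent_iff hj ha
  rwa [Hauser2010.isPthPowerExponent_iff, Hauser2010.isPthPowerExponent_iff] at h

/-- Permissibility read pointwise: `q ≤ degIn S a` for every `a ∈ A`. [folklore] -/
theorem le_degIn_of_spinePermissible {A : SpinePos} (hS : SpinePermissible q S A) {a : Fin 4 →₀ ℕ}
    (ha : a ∈ A) : q ≤ degIn S a :=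
  hS.2 a ha

/-! ## §2 Membership and cleanness -/

/-- Membership in the pure move. [folklore] -/
theorem mem_pureMove_iff {A : SpinePos} {a' : Fin 4 →₀ ℕ} :
    a' ∈ pureMove q S j A ↔ ∃ a ∈ A, chartExponent q S j a = a' :=
  Finset.mem_image

/-- The chart image of a point of `A` lies in the pure move. [folklore] -/
theorem chartExponent_mem_pureMove {A : SpinePos} {a : Fin 4 →₀ ℕ} (ha : a ∈ A) :
    chartExponent q S j a ∈ pureMove q S j A :=
  Finset.mem_image_of_mem _ ha

/-- Membership in the spine move: in the pure move and not `q`-divisible. [folklore] -/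
theorem mem_spineMove_iff {A : SpinePos} {a' : Fin 4 →₀ ℕ} :
    a' ∈ spineMove q S j A ↔ a' ∈ pureMove q S j A ∧ ¬ ∀ i, q ∣ a' i :=
  Finset.mem_filter

/-- **A spine move always returns a `q`-clean position** (the deletion is built in). [folklore] -/
theorem spineMove_clean (q : ℕ) (S : Finset (Fin 4)) (j : Fin 4) (A : SpinePos) :
    ∀ a ∈ spineMove q S j A, ¬ ∀ i, q ∣ a i :=
  fun _ ha => (mem_spineMove_iff.mp ha).2

/-- **A pure move from a `q`-clean permissible position returns a `q`-clean position** (chart `j ∈ S`).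
[folklore] -/
theorem pureMove_clean {A : SpinePos} (hS : SpinePermissible q S A) (hj : j ∈ S)
    (hA : ∀ a ∈ A, ¬ ∀ i, q ∣ a i) : ∀ a ∈ pureMove q S j A, ¬ ∀ i, q ∣ a i := by
  intro a' ha'
  obtain ⟨a, ha, rfl⟩ := mem_pureMove_iff.mp ha'
  rw [dvd_chartExponent_iff hj (hS.2 a ha)]
  exact hA a ha

/-- The spine move is the pure move of the `q`-clean part of the position (chart `j ∈ S`, `S` permissible):
exactly the `q`-divisible points of `A` are deleted. [folklore] -/
theorem spineMove_eq_pureMove_filter {A : SpinePos} (hS : SpinePermissible q S A) (hj : j ∈ S) :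
    spineMove q S j A = pureMove q S j (A.filter fun a => ¬ ∀ i, q ∣ a i) := by
  ext a'
  rw [mem_spineMove_iff, mem_pureMove_iff, mem_pureMove_iff]
  constructor
  · rintro ⟨⟨a, ha, rfl⟩, hnd⟩
    refine ⟨a, Finset.mem_filter.mpr ⟨ha, ?_⟩, rfl⟩
    rwa [dvd_chartExponent_iff hj (hS.2 a ha)] at hnd
  · rintro ⟨a, ha, rfl⟩
    obtain ⟨haA, hna⟩ := Finset.mem_filter.mp ha
    refine ⟨⟨a, haA, rfl⟩, ?_⟩
    rwa [dvd_chartExponent_iff hj (hS.2 a haA)]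

/-- **No deletion on a clean position**: from a `q`-clean position a permissible spine move (chart `j ∈ S`)
IS the pure move of Hironaka's game (desk WORD #23 (b)). [folklore] -/
theorem spineMove_eq_pureMove {A : SpinePos} (hS : SpinePermissible q S A) (hj : j ∈ S)
    (hA : ∀ a ∈ A, ¬ ∀ i, q ∣ a i) : spineMove q S j A = pureMove q S j A := by
  rw [spineMove_eq_pureMove_filter hS hj, Finset.filter_true_of_mem hA]

/-- Conversely, a `q`-divisible point of a permissible position is deleted by every spine move through a
chart `j ∈ S`: its chart image is NOT in the spine move (when the chart law is read on that point).
[folklore] -/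
theorem chartExponent_not_mem_spineMove {A : SpinePos} (hS : SpinePermissible q S A) (hj : j ∈ S)
    {a : Fin 4 →₀ ℕ} (ha : a ∈ A) (hdiv : ∀ i, q ∣ a i) :
    chartExponent q S j a ∉ spineMove q S j A := by
  intro h
  exact (mem_spineMove_iff.mp h).2 ((dvd_chartExponent_iff hj (hS.2 a ha)).mpr hdiv)

/-! ## §3 Cardinalities -/

/-- The chart law is injective on a permissible position (p-2's `chartExponent_injOn`). [folklore] -/
theorem chartExponent_injOn_of_spinePermissible {A : SpinePos} (hS : SpinePermissible q S A)
    (hj : j ∈ S) : Set.InjOn (chartExponent q S j) (A : Set (Fin 4 →₀ ℕ)) :=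
  fun _ ha _ hb h => Perm2Bound.chartExponent_injOn hj (hS.2 _ ha) (hS.2 _ hb) h

/-- **`|pureMove A| = |A|`** on a permissible position (chart `j ∈ S`). [folklore] -/
theorem card_pureMove {A : SpinePos} (hS : SpinePermissible q S A) (hj : j ∈ S) :
    (pureMove q S j A).card = A.card :=
  Finset.card_image_of_injOn (chartExponent_injOn_of_spinePermissible hS hj)

/-- `|pureMove A| ≤ |A|` with no hypothesis. [folklore] -/
theorem card_pureMove_le (q : ℕ) (S : Finset (Fin 4)) (j : Fin 4) (A : SpinePos) :
    (pureMove q S j A).card ≤ A.card :=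
  Finset.card_image_le

/-- **Deletions are counted exactly**: `|spineMove A| + #{a ∈ A : q ∣ a} = |A|` on a permissible position
(chart `j ∈ S`). [folklore] -/
theorem card_spineMove_add {A : SpinePos} (hS : SpinePermissible q S A) (hj : j ∈ S) :
    (spineMove q S j A).card + (A.filter fun a => ∀ i, q ∣ a i).card = A.card := by
  have hperm : SpinePermissible q S (A.filter fun a => ¬ ∀ i, q ∣ a i) :=
    ⟨hS.1, fun a ha => hS.2 a (Finset.mem_filter.mp ha).1⟩
  rw [spineMove_eq_pureMove_filter hS hj, card_pureMove hperm hj]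
  have := Finset.card_filter_add_card_filter_not (s := A) (fun a => ∀ i, q ∣ a i)
  omega

/-- Clean ⇒ `|spineMove A| = |A|`. [folklore] -/
theorem card_spineMove_eq {A : SpinePos} (hS : SpinePermissible q S A) (hj : j ∈ S)
    (hA : ∀ a ∈ A, ¬ ∀ i, q ∣ a i) : (spineMove q S j A).card = A.card := by
  rw [spineMove_eq_pureMove hS hj hA, card_pureMove hS hj]

/-- A deletion strictly lowers the cardinality: if some point of a permissible `A` is `q`-divisible then
`|spineMove A| < |A|` (chart `j ∈ S`). [folklore] -/
theorem card_spineMove_lt {A : SpinePos} (hS : SpinePermissible q S A) (hj : j ∈ S)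
    {a : Fin 4 →₀ ℕ} (ha : a ∈ A) (hdiv : ∀ i, q ∣ a i) : (spineMove q S j A).card < A.card := by
  have h := card_spineMove_add hS hj
  have hpos : 0 < (A.filter fun a => ∀ i, q ∣ a i).card :=
    Finset.card_pos.mpr ⟨a, Finset.mem_filter.mpr ⟨ha, hdiv⟩⟩
  omega

/-! ## §4 One-step play forms -/

/-- Along a spine play every position from index `1` on is `q`-clean. [folklore] -/
theorem isSpinePlay_clean_succ {σ : SpineStrategy} {A : ℕ → SpinePos} (hA : IsSpinePlay q σ A) (k : ℕ) :
    ∀ a ∈ A (k + 1), ¬ ∀ i, q ∣ a i := by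
  obtain ⟨_, j, _, hj⟩ := hA k
  rw [hj]
  exact spineMove_clean q _ j _

/-- A spine step from a `q`-clean position under a strategy that is permissible there is the pure step:
if `A (k+1) = spineMove q (σ (A k)) j (A k)` with `j ∈ σ (A k)`, `σ (A k)` permissible at `A k` and `A k`
clean, then `A (k+1) = pureMove q (σ (A k)) j (A k)`. [folklore] -/
theorem spine_step_eq_pureMove {σ : SpineStrategy} {A : ℕ → SpinePos} {k : ℕ} {j : Fin 4}
    (hperm : SpinePermissible q (σ (A k)) (A k)) (hj : j ∈ σ (A k))
    (hclean : ∀ a ∈ A k, ¬ ∀ i, q ∣ a i) (hstep : A (k + 1) = spineMove q (σ (A k)) j (A k)) :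
    A (k + 1) = pureMove q (σ (A k)) j (A k) := by
  rw [hstep, spineMove_eq_pureMove hperm hj hclean]

/-- **One-step transfer**: in a spine play following a strategy permissible at non-won positions, every step
taken from index `k + 1` (a clean position) is a pure step. [folklore] -/
theorem isSpinePlay_step_eq_pureMove {σ : SpineStrategy} {A : ℕ → SpinePos}
    (hσ : ∀ B, ¬ SpineWon q B → SpinePermissible q (σ B) B) (hA : IsSpinePlay q σ A) (k : ℕ) :
    ∃ j ∈ σ (A (k + 1)), A (k + 1 + 1) = pureMove q (σ (A (k + 1))) j (A (k + 1)) := by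
  obtain ⟨hnw, j, hj, hstep⟩ := hA (k + 1)
  exact ⟨j, hj, spine_step_eq_pureMove (hσ _ hnw) hj (isSpinePlay_clean_succ hA k) hstep⟩

end SpineClean

end Summit.ResolutionOfSingularities.ResolutionOfSingularities.Theorems.PIDim4
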